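import Summits.NavierStokesRegularity.NavierStokesRegularity.Theorems.SoloSalvageAlneel2026Reverse
import Mathlib.MeasureTheory.Measure.Lebesgue.EqHaar
import HarnessLib

/-!
# Solo salvage for claim C156 `Alneel2026` (cell `ns-claims`, D-0090), third file: Step 2 on data — every datum
# HAS A CENTRE (the charitable half-energy radius `R⁻` of Definition 1.2 is attained), kernel

Claim skeleton: `Literature/Claims/NS/Alneel2026.lean` (Zenodo 21706638; typist `ns-claims-typist-3`). Row C156 is
ADJUDICATED #145 (head `Step_P3tail`); the RE-KEY clause of the row is display (6) `Step6_display`, whose field face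
`Step6_field C` quantifies over CENTRES `IsCentre E₀ w x₀` (Step 2 p.2 l.15–23 «Let x₀, R = R(t) achieve the
supremum in Definition 1.2»). This file (seat `ns-claims-salvage-p3` g5; TRUE column, records-grade, off the verdict)
proves that centres exist:

* `step2_field_holds : Step2_field` — for every datum `w` (smooth, divergence-free, all Sobolev norms finite), with
  `E₀ = E(w) = ½∫|w|²`: `R⁻(w) < ∞` and some `x₀` satisfies `∫_{B(x₀, R⁻)}|w|² ≥ E₀/2`.

Proof (Lions-type concentration compactness, elementary form): the finite measure `ν = |w|²dx` is absolutely
continuous, so spheres are `ν`-null and `ν(closed ball) = ν(open ball)`; its tail `ν(ℝ³ ∖ B̄(0,K))` is `< E₀/2` for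
some `K`, which confines the candidate centres to a bounded set; the sets `A_n = {x : ν(B̄(x, r* + 1/(n+1))) ≥ E₀/2}`
(`r* = inf capRadii`) are non-empty (near-optimal radii), decreasing, closed (continuity of `ν` from above at closed
balls) and bounded, so Cantor's intersection theorem gives `x₀` with `ν(B̄(x₀, r*)) ≥ E₀/2`, i.e. `ν(B(x₀, r*)) ≥ E₀/2`.
Uses the landed `capRadii_nonempty` / `lintegral_enorm_sq_lt_top_of_isDatum` (`SoloSalvageAlneel2026Reverse`).
Solo lane, no item.

WHAT THIS IS NOT: not a claim about NS regularity or blow-up; not a claim about any author beyond the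
typed locator.
-/

noncomputable section

set_option linter.dupNamespace false

open Set MeasureTheory Filter Metric
open scoped ENNReal NNReal Topology

namespace Summit.NavierStokesRegularity.NavierStokesRegularity.Theorems.Alneel2026Salvage

open Literature.Analysis Literature.Analysis.FluidPDE
open Literature.Claims.NS Literature.Claims.NS.Alneel2026
open Literature.Claims.NS.Chae2007 (IsDatum)

/-! ## The energy measure `ν = |w|² dx` -/

/-- The energy measure of a field: `ν(S) = ∫_S |w|²`. [folklore] -/
def energyMeasure (w : E3 → E3) : Measure E3 := volume.withDensity fun x => ‖w x‖ₑ ^ 2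

/-- `locEnergy w x r = ν(B(x,r))`. [folklore] -/
theorem locEnergy_eq_energyMeasure_ball (w : E3 → E3) (x : E3) (r : ℝ) :
    locEnergy w x r = energyMeasure w (ball x r) := by
  rw [energyMeasure, withDensity_apply _ measurableSet_ball]; rfl

/-- `ν(ℝ³) = ∫|w|²`. [folklore] -/
theorem energyMeasure_univ (w : E3 → E3) : energyMeasure w univ = ∫⁻ x, ‖w x‖ₑ ^ 2 := by
  rw [energyMeasure, withDensity_apply _ MeasurableSet.univ, Measure.restrict_univ]

/-- Spheres are `ν`-null (`ν ≪` Lebesgue, `|sphere| = 0`). [folklore] -/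
theorem energyMeasure_sphere (w : E3 → E3) (x : E3) (r : ℝ) : energyMeasure w (sphere x r) = 0 :=
  withDensity_absolutelyContinuous _ _ (Measure.addHaar_sphere volume x r)

/-- `ν(closed ball) = ν(open ball)`. [folklore] -/
theorem energyMeasure_closedBall (w : E3 → E3) (x : E3) (r : ℝ) :
    energyMeasure w (closedBall x r) = energyMeasure w (ball x r) := by
  refine le_antisymm ?_ (measure_mono ball_subset_closedBall)
  rw [← ball_union_sphere]
  exact (measure_union_le _ _).trans (by rw [energyMeasure_sphere, add_zero])

/-- Continuity of `ν` from above at closed balls: `ν(B̄(x,r)) = ⨅ₙ ν(B̄(x, r + 1/(n+1)))` (for a finite `ν`).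
[folklore] -/
theorem energyMeasure_closedBall_eq_iInf (w : E3 → E3) (hfin : energyMeasure w univ < ⊤) (x : E3) (r : ℝ) :
    energyMeasure w (closedBall x r) = ⨅ n : ℕ, energyMeasure w (closedBall x (r + 1 / (n + 1))) := by
  have hanti : Antitone fun n : ℕ => closedBall x (r + 1 / (n + 1)) := by
    intro a b hab
    refine closedBall_subset_closedBall ?_
    have : (1 : ℝ) / (b + 1) ≤ 1 / (a + 1) :=
      one_div_le_one_div_of_le (by positivity) (by exact_mod_cast Nat.succ_le_succ hab)
    linarith
  have hinter : (⋂ n : ℕ, closedBall x (r + 1 / (n + 1))) = closedBall x r := by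
    apply Subset.antisymm
    · intro y hy
      rw [mem_iInter] at hy
      rw [mem_closedBall]
      refine le_of_forall_pos_lt_add fun ε hε => ?_
      obtain ⟨n, hn⟩ := exists_nat_one_div_lt hε
      have := mem_closedBall.1 (hy n)
      linarith
    · exact subset_iInter fun n => closedBall_subset_closedBall (le_add_of_nonneg_right (by positivity))
  rw [← hinter]
  exact hanti.measure_iInter (fun n => measurableSet_closedBall.nullMeasurableSet)
    ⟨0, (measure_lt_top_of_subset (subset_univ _) hfin.ne).ne⟩

/-- The tail of `ν` is eventually small: if `0 < c` there is `K` with `ν(ℝ³ ∖ B̄(0,K)) < c`. [folklore] -/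
theorem exists_energyMeasure_compl_closedBall_lt (w : E3 → E3) (hfin : energyMeasure w univ < ⊤) {c : ℝ≥0∞}
    (hc : 0 < c) : ∃ K : ℕ, energyMeasure w (closedBall (0 : E3) K)ᶜ < c := by
  have hanti : Antitone fun n : ℕ => (closedBall (0 : E3) (n : ℝ))ᶜ := fun a b hab =>
    compl_subset_compl.2 (closedBall_subset_closedBall (by exact_mod_cast hab))
  have h := tendsto_measure_iInter_atTop (μ := energyMeasure w) (s := fun n : ℕ => (closedBall (0 : E3) (n : ℝ))ᶜ)
    (fun n => measurableSet_closedBall.compl.nullMeasurableSet) hanti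
    ⟨0, (measure_lt_top_of_subset (subset_univ _) hfin.ne).ne⟩
  have hempty : (⋂ n : ℕ, (closedBall (0 : E3) (n : ℝ))ᶜ) = ∅ := by
    rw [← compl_iUnion, iUnion_closedBall_nat, compl_univ]
  rw [hempty, measure_empty] at h
  exact ((tendsto_order.1 h).2 c hc).exists

/-! ## Every datum has a centre -/

/-- **Step 2 on data holds** (Step 2 p.2 l.15–23, field face `Step2_field`): for every datum `w` there is a centre
— `R⁻(w) < ∞` and some ball `B(x₀, R⁻)` holds at least `E₀/2 = ¼∫|w|²`. [cite: Alneel2026, Step 2 (5) p.2 l.15–23]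
[cite: Lions1984, Lemma I.1] -/
theorem step2_field_holds : Step2_field := by
  intro w hw
  have hT : ∫⁻ x, ‖w x‖ₑ ^ 2 < ⊤ := lintegral_enorm_sq_lt_top_of_isDatum hw
  have hfin : energyMeasure w univ < ⊤ := by rwa [energyMeasure_univ]
  have hE0 : 0 ≤ energyF w := by unfold energyF; positivity
  rcases hE0.eq_or_lt with hE | hE
  · -- zero energy: every point is a centre (`E₀/2 = 0`), and `1` is a cap radius
    have h1 : (1 : ℝ) ∈ capRadii (energyF w) w :=
      ⟨one_pos, 0, by rw [← hE]; simp⟩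
    refine ⟨0, ?_, ?_⟩
    · refine lt_of_le_of_lt (sInf_le ⟨1, h1, rfl⟩) ENNReal.ofReal_lt_top
    · rw [← hE]; simp
  -- positive energy
  set c : ℝ≥0∞ := ENNReal.ofReal (energyF w / 2) with hc
  have hc0 : 0 < c := by rw [hc]; exact ENNReal.ofReal_pos.2 (by linarith)
  set S : Set ℝ := capRadii (energyF w) w with hS
  have hSne : S.Nonempty := capRadii_nonempty hw hE
  have hSbdd : BddBelow S := ⟨0, fun r hr => hr.1.le⟩
  set rstar : ℝ := sInf S with hrstar
  have hr0 : 0 ≤ rstar := le_csInf hSne fun r hr => hr.1.le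
  -- `Rinf = ofReal rstar`
  have hRinf : Rinf (energyF w) w = ENNReal.ofReal rstar := by
    rw [Rinf, hrstar, hS]
    exact (Monotone.map_csInf_of_continuousAt (f := ENNReal.ofReal) ENNReal.continuous_ofReal.continuousAt
      (fun a b h => ENNReal.ofReal_le_ofReal h) hSne hSbdd).symm
  -- tail: centres of good balls stay in a bounded set
  obtain ⟨K, hK⟩ := exists_energyMeasure_compl_closedBall_lt w hfin hc0
  -- the nested sets
  set ρ : ℕ → ℝ := fun n => rstar + 1 / (n + 1) with hρ
  set A : ℕ → Set E3 := fun n => {x | c ≤ energyMeasure w (closedBall x (ρ n))} with hA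
  -- non-empty: a cap radius `r < ρ n` with its centre
  have hAne : ∀ n, (A n).Nonempty := by
    intro n
    have hlt : sInf S < rstar + 1 / (n + 1) := by rw [← hrstar]; linarith [(by positivity : (0:ℝ) < 1 / (n + 1))]
    obtain ⟨r, hrS, hrlt⟩ := exists_lt_of_csInf_lt hSne hlt
    obtain ⟨_, x₀, hx₀⟩ := hrS
    refine ⟨x₀, ?_⟩
    show c ≤ energyMeasure w (closedBall x₀ (ρ n))
    rw [hc, locEnergy_eq_energyMeasure_ball] at *
    exact hx₀.trans (measure_mono (ball_subset_closedBall.trans (closedBall_subset_closedBall hrlt.le)))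
  -- decreasing
  have hAmono : ∀ n, A (n + 1) ⊆ A n := by
    intro n x hx
    have hρle : ρ (n + 1) ≤ ρ n := by
      simp only [hρ]
      have : (1 : ℝ) / ((n + 1 : ℕ) + 1) ≤ 1 / (n + 1) :=
        one_div_le_one_div_of_le (by positivity) (by push_cast; linarith)
      linarith
    exact le_trans hx (measure_mono (closedBall_subset_closedBall hρle))
  -- closed: continuity from above at closed balls
  have hAcl : ∀ n, IsClosed (A n) := by
    intro n
    refine isClosed_of_closure_subset fun x hx => ?_
    show c ≤ energyMeasure w (closedBall x (ρ n))
    rw [energyMeasure_closedBall_eq_iInf w hfin]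
    refine le_iInf fun m => ?_
    have hpos : (0 : ℝ) < 1 / (m + 1) := by positivity
    obtain ⟨y, hy, hxy⟩ := Metric.mem_closure_iff.1 hx _ hpos
    have hsub : closedBall y (ρ n) ⊆ closedBall x (ρ n + 1 / (m + 1)) := by
      intro z hz
      rw [mem_closedBall] at hz ⊢
      have := dist_triangle z y x
      rw [dist_comm x y] at hxy
      linarith
    exact (le_trans hy (measure_mono hsub))
  -- bounded: a good closed ball must meet `B̄(0,K)`
  have hAbdd : A 0 ⊆ closedBall (0 : E3) (K + ρ 0) := by
    intro x hx
    by_contra hfar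
    rw [mem_closedBall, not_le, dist_zero_right] at hfar
    have hsub : closedBall x (ρ 0) ⊆ (closedBall (0 : E3) K)ᶜ := by
      intro z hz hzK
      rw [mem_closedBall, dist_zero_right] at hzK
      rw [mem_closedBall] at hz
      have := norm_le_norm_add_norm_sub' x z  -- ‖x‖ ≤ ‖z‖ + ‖x - z‖
      rw [← dist_eq_norm, dist_comm] at this
      linarith
    have := (le_trans hx (measure_mono hsub)).trans_lt hK
    exact lt_irrefl _ this
  have hAcpt : IsCompact (A 0) :=
    (isCompact_closedBall (0 : E3) (K + ρ 0)).of_isClosed_subset (hAcl 0) hAbdd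
  -- Cantor
  obtain ⟨x₀, hx₀⟩ := IsCompact.nonempty_iInter_of_sequence_nonempty_isCompact_isClosed A hAmono hAne hAcpt hAcl
  rw [mem_iInter] at hx₀
  refine ⟨x₀, by rw [hRinf]; exact ENNReal.ofReal_lt_top, ?_⟩
  -- `ν(B̄(x₀, r*)) ≥ c`, hence the open ball
  rw [hRinf, ENNReal.toReal_ofReal hr0, locEnergy_eq_energyMeasure_ball, ← energyMeasure_closedBall,
    energyMeasure_closedBall_eq_iInf w hfin]
  exact le_iInf fun n => hx₀ n

end Summit.NavierStokesRegularity.NavierStokesRegularity.Theorems.Alneel2026Salvage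

end
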